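import Mathlib
import Summits.CriticalPhenomena.PercolationContinuityZ3.Theorems.PercNearOneGluingNoHeavyLowerTailOrderedDifferencesCubicReduction

/-!
# Finite-field certificates for cubic unit classes (heptagonal, plastic, conductor 9 over `𝔽₈`)

Helper file for crux `stmt-CriticalPhenomena-4575` (`NoHeavyLowerTail`, route `PercNearOneGluingNoHeavy`), new-inequality factory
seat `prim-ineq-gen-3` (gen 28).  Everything here is PROVED; no definitions.  Discharges the two side hypotheses of
`…OrderedDifferencesCubicReduction.linearIndependent_pencil_cubic_of_reduction` from finite checks:

* `eq_zero_of_cubic_no_root` — if `X³ = uX² + vX + w` has no root in a field `L` and `θ` is a root in an extension `ι : L →+* M`, then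
  `ι a + ι b θ + ι e θ² = 0` forces `a = b = e = 0` (for a cubic, no root ⟺ irreducible; elementary division argument: either `θ ∈ ι(L)`
  or the cofactor of the would-be quadratic factor has the root `u − β`).
* `dvd_of_cubic_no_root_mod` (no root in `ZMod p`, a `decide`-able fact), `cubic_no_rat_root_of_no_int_root` (rational root theorem for a
  monic cubic), `int3_indep_of_cubic_no_int_root`.
* `linearIndependent_pencil_cubic_of_finite_certificate` — ★ the packaged transfer: no integer root + no root mod `p` + independence of the
  pencil rows at `θ` (char `p`) ⟹ independence at `t` (char `0`).
* instances `linearIndependent_pencil_heptagonal_of_charTwo` (`t³ = 2t² + t − 1`), `linearIndependent_pencil_plastic_of_charTwo` (`t³ = t + 1`),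
  `linearIndependent_pencil_conductorNine_of_charTwo` (`t³ = 3t − 1`), all via `θ³ = θ + 1` in characteristic 2 (`𝔽₈`): a machine check
  'rank_{𝔽₈} U(θ) = |𝒜|' certifies (C0) for `𝒜` at all three cubic unit classes at once.
(prim-ineq-gen-3 gen 28, 2026-08-25.)
-/

namespace Summit.CriticalPhenomena.PercolationContinuityZ3.Theorems

namespace OrderedDifferences

open Finset
open scoped FinsetFamily

variable {α : Type*} [DecidableEq α]

/-- **No root in `L` ⟹ no quadratic or linear relation over `L`.**  If the cubic `X³ = uX² + vX + w` has no root in the field `L` and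
`θ` is a root in a field `M ⊇ ι(L)`, then `ι a + ι b θ + ι e θ² = 0` forces `a = b = e = 0` (division of the cubic by the would-be
quadratic factor: either `θ ∈ ι(L)` or the cofactor has the root `u − β`). -/
theorem eq_zero_of_cubic_no_root {L M : Type*} [Field L] [Field M] (ι : L →+* M) (u v w : L) {θ : M}
    (hθ : θ * θ * θ = ι u * θ * θ + ι v * θ + ι w) (hno : ∀ r : L, r * r * r ≠ u * r * r + v * r + w)
    (a b e : L) (h : ι a + ι b * θ + ι e * θ * θ = 0) : a = 0 ∧ b = 0 ∧ e = 0 := by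
  have hι := ι.injective
  have root : ∀ r : L, θ = ι r → False := by
    intro r hr
    apply hno r
    apply hι
    simp only [map_add, map_mul]
    rw [← hr]
    exact hθ
  by_cases he : e = 0
  · subst he
    by_cases hb : b = 0
    · subst hb
      have ha : ι a = 0 := by simpa using h
      exact ⟨hι (by rw [ha, map_zero]), rfl, rfl⟩
    · exfalso
      apply root (-a / b)
      have hbι : ι b ≠ 0 := fun h0 => hb (hι (by rw [h0, map_zero]))
      have h' : ι a + ι b * θ = 0 := by simpa using h
      rw [map_div₀, map_neg, eq_div_iff hbι]
      linear_combination h'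
  · exfalso
    have heι : ι e ≠ 0 := fun h0 => he (hι (by rw [h0, map_zero]))
    set α := -a / e with hα
    set β := -b / e with hβ
    have h2 : θ * θ = ι α + ι β * θ := by
      have eα : ι α * ι e = -ι a := by rw [hα, map_div₀, map_neg]; field_simp
      have eβ : ι β * ι e = -ι b := by rw [hβ, map_div₀, map_neg]; field_simp
      have : (θ * θ - ι α - ι β * θ) * ι e = 0 := by linear_combination h - eα - θ * eβ
      rcases mul_eq_zero.mp this with h0 | h0
      · linear_combination h0
      · exact absurd h0 heι
    have e1 : θ * θ * θ = ι α * θ + ι β * (ι α + ι β * θ) := by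
      calc θ * θ * θ = (ι α + ι β * θ) * θ := by rw [h2]
        _ = ι α * θ + ι β * (θ * θ) := by ring
        _ = ι α * θ + ι β * (ι α + ι β * θ) := by rw [h2]
    have e2 : θ * θ * θ = ι u * (ι α + ι β * θ) + ι v * θ + ι w := by
      rw [← h2]; linear_combination hθ
    have h3 : ι (α + β * β - u * β - v) * θ = ι (u * α + w - α * β) := by
      simp only [map_add, map_sub, map_mul]
      linear_combination e2 - e1
    by_cases hγ : α + β * β - u * β - v = 0
    · have hδ : u * α + w - α * β = 0 := by
        apply hι
        rw [map_zero]
        rw [hγ, map_zero, zero_mul] at h3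
        exact h3.symm
      apply hno (u - β)
      linear_combination (u - β) * hγ - hδ
    · apply root ((u * α + w - α * β) / (α + β * β - u * β - v))
      have hγι : ι (α + β * β - u * β - v) ≠ 0 := fun h0 => hγ (hι (by rw [h0, map_zero]))
      rw [map_div₀, eq_div_iff hγι]
      linear_combination h3

/-- **No root modulo `p` ⟹ `1, θ, θ²` independent over `𝔽_p`.** -/
theorem dvd_of_cubic_no_root_mod {F : Type*} [Field F] (p : ℕ) [Fact p.Prime] [CharP F p] (u v w : ℤ) {θ : F}
    (hθ : θ * θ * θ = (u : F) * θ * θ + (v : F) * θ + (w : F))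
    (hno : ∀ r : ZMod p, r * r * r ≠ (u : ZMod p) * r * r + (v : ZMod p) * r + (w : ZMod p))
    (a b e : ℤ) (h : (a : F) + (b : F) * θ + (e : F) * θ * θ = 0) : (p : ℤ) ∣ a ∧ (p : ℤ) ∣ b ∧ (p : ℤ) ∣ e := by
  let ι : ZMod p →+* F := ZMod.castHom (dvd_refl p) F
  have hθ' : θ * θ * θ = ι (u : ZMod p) * θ * θ + ι (v : ZMod p) * θ + ι (w : ZMod p) := by simpa [ι] using hθ
  have h' : ι (a : ZMod p) + ι (b : ZMod p) * θ + ι (e : ZMod p) * θ * θ = 0 := by simpa [ι] using h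
  obtain ⟨ha, hb, he⟩ := eq_zero_of_cubic_no_root ι _ _ _ hθ' hno _ _ _ h'
  exact ⟨(ZMod.intCast_zmod_eq_zero_iff_dvd a p).mp ha, (ZMod.intCast_zmod_eq_zero_iff_dvd b p).mp hb,
    (ZMod.intCast_zmod_eq_zero_iff_dvd e p).mp he⟩

/-- Rational root theorem for a monic cubic: no integer root ⟹ no rational root. -/
theorem cubic_no_rat_root_of_no_int_root (u v w : ℤ) (hno : ∀ n : ℤ, n * n * n ≠ u * n * n + v * n + w) :
    ∀ q : ℚ, q * q * q ≠ (u : ℚ) * q * q + (v : ℚ) * q + (w : ℚ) := by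
  intro q hq
  set n : ℤ := q.num with hn
  set d : ℤ := (q.den : ℤ) with hd
  have hd0 : (d : ℚ) ≠ 0 := by rw [hd]; exact_mod_cast q.den_nz
  have hnq : (n : ℚ) = q * d := by
    rw [hn, hd]
    push_cast
    exact (Rat.mul_den_eq_num q).symm
  have eqQ : (n : ℚ) * n * n = u * n * n * d + v * n * d * d + w * d * d * d := by
    rw [hnq]; linear_combination ((d : ℚ) * d * d) * hq
  have eqZ : n * n * n = u * n * n * d + v * n * d * d + w * d * d * d := by exact_mod_cast eqQ
  have hcop : IsCoprime d n := by
    rw [Int.isCoprime_iff_gcd_eq_one, hd, hn]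
    have := q.reduced
    rw [Int.gcd, Int.natAbs_natCast]
    exact Nat.Coprime.symm this
  have hdn : d ∣ n := by
    have h3 : d ∣ n * n * n := ⟨u * n * n + v * n * d + w * d * d, by linear_combination eqZ⟩
    have h2 : d ∣ n * n := hcop.dvd_of_dvd_mul_right h3
    exact hcop.dvd_of_dvd_mul_right h2
  have hd1 : d = 1 := by
    have hu : IsUnit d := by
      have : d ∣ 1 := by
        have h1 : (Int.gcd d n : ℤ) = 1 := by exact_mod_cast (Int.isCoprime_iff_gcd_eq_one.mp hcop)
        rw [← h1]; exact Int.dvd_coe_gcd (dvd_refl d) hdn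
      exact isUnit_of_dvd_one this
    rcases Int.isUnit_iff.mp hu with h | h
    · exact h
    · exfalso; have : (0 : ℤ) < d := by rw [hd]; exact_mod_cast q.den_pos
      omega
  apply hno n
  rw [hd1] at eqZ
  linear_combination eqZ

/-- No integer root of `X³ = uX² + vX + w` ⟹ `1, t, t²` are `ℤ`-independent for every root `t` in a field of characteristic `0`. -/
theorem int3_indep_of_cubic_no_int_root {K : Type*} [Field K] [CharZero K] (u v w : ℤ) {t : K}
    (ht : t * t * t = (u : K) * t * t + (v : K) * t + (w : K)) (hno : ∀ n : ℤ, n * n * n ≠ u * n * n + v * n + w)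
    (a b e : ℤ) (h : (a : K) + (b : K) * t + (e : K) * t * t = 0) : a = 0 ∧ b = 0 ∧ e = 0 := by
  let ι : ℚ →+* K := algebraMap ℚ K
  have hθ' : t * t * t = ι (u : ℚ) * t * t + ι (v : ℚ) * t + ι (w : ℚ) := by simpa [ι] using ht
  have h' : ι (a : ℚ) + ι (b : ℚ) * t + ι (e : ℚ) * t * t = 0 := by simpa [ι] using h
  obtain ⟨ha, hb, he⟩ := eq_zero_of_cubic_no_root ι _ _ _ hθ' (cubic_no_rat_root_of_no_int_root u v w hno) _ _ _ h'
  exact ⟨by exact_mod_cast ha, by exact_mod_cast hb, by exact_mod_cast he⟩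

/-- **The packaged finite certificate, cubic case.**  `X³ = uX² + vX + w` with no integer root and no root modulo the prime `p`; `θ` a
root in a field of characteristic `p`, `t` a root in a field of characteristic `0`: independence of the pencil rows at `θ` implies
independence at `t`. -/
theorem linearIndependent_pencil_cubic_of_finite_certificate (𝒜 : Finset (Finset α)) (u v w : ℤ) (p : ℕ) [Fact p.Prime]
    (hnoZ : ∀ n : ℤ, n * n * n ≠ u * n * n + v * n + w)
    (hnoP : ∀ r : ZMod p, r * r * r ≠ (u : ZMod p) * r * r + (v : ZMod p) * r + (w : ZMod p))
    {F : Type*} [Field F] [CharP F p] {θ : F} (hθ : θ * θ * θ = (u : F) * θ * θ + (v : F) * θ + (w : F))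
    (hF : LinearIndependent F (fun A : 𝒜 => fun E : (𝒜 \\ 𝒜 : Finset (Finset α)) =>
      (if (E : Finset α) ⊆ (A : Finset α) then (1 : F) else 0) +
        θ * (if Disjoint (E : Finset α) (A : Finset α) then (1 : F) else 0)))
    {K : Type*} [Field K] [CharZero K] {t : K} (ht : t * t * t = (u : K) * t * t + (v : K) * t + (w : K)) :
    LinearIndependent K (fun A : 𝒜 => fun E : (𝒜 \\ 𝒜 : Finset (Finset α)) =>
      (if (E : Finset α) ⊆ (A : Finset α) then (1 : K) else 0) +
        t * (if Disjoint (E : Finset α) (A : Finset α) then (1 : K) else 0)) :=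
  linearIndependent_pencil_cubic_of_reduction 𝒜 u v w (Fact.out : p.Prime).one_lt hθ
    (dvd_of_cubic_no_root_mod p u v w hθ hnoP) hF ht (int3_indep_of_cubic_no_int_root u v w ht hnoZ)

/-- `X³ + X + 1` has no root modulo 2 (it is irreducible over `𝔽₂`): the three classes below all reduce to it. -/
private theorem noRootMod2_hept : ∀ r : ZMod 2, r * r * r ≠ ((2 : ℤ) : ZMod 2) * r * r + ((1 : ℤ) : ZMod 2) * r + ((-1 : ℤ) : ZMod 2) := by
  decide
/-- `X³ + X + 1` has no root modulo 2 (plastic form of the coefficients). -/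
private theorem noRootMod2_plastic : ∀ r : ZMod 2, r * r * r ≠ ((0 : ℤ) : ZMod 2) * r * r + ((1 : ℤ) : ZMod 2) * r + ((1 : ℤ) : ZMod 2) := by
  decide
/-- `X³ + X + 1` has no root modulo 2 (conductor-9 form of the coefficients). -/
private theorem noRootMod2_cond9 : ∀ r : ZMod 2, r * r * r ≠ ((0 : ℤ) : ZMod 2) * r * r + ((3 : ℤ) : ZMod 2) * r + ((-1 : ℤ) : ZMod 2) := by
  decide

/-- The heptagonal cubic `t³ = 2t² + t − 1` (`t = 2cos(2π/7)`-type unit) has no integer root. -/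
private theorem noIntRoot_hept : ∀ n : ℤ, n * n * n ≠ 2 * n * n + 1 * n + (-1) := by
  intro n h
  rcases le_or_gt n (-1) with h1 | h1
  · nlinarith [mul_nonneg (by linarith : (0:ℤ) ≤ -1 - n) (mul_self_nonneg n),
      mul_nonneg (by linarith : (0:ℤ) ≤ -1 - n) (by linarith : (0:ℤ) ≤ -1 - 3 * n)]
  rcases le_or_gt 3 n with h2 | h2
  · nlinarith [mul_nonneg (by linarith : (0:ℤ) ≤ n - 3) (mul_self_nonneg n), sq_nonneg (2 * n - 1)]
  interval_cases n <;> omega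

/-- `t³ = t + 1` has no integer root. -/
private theorem noIntRoot_plastic : ∀ n : ℤ, n * n * n ≠ 0 * n * n + 1 * n + 1 := by
  intro n h
  rcases le_or_gt n (-1) with h1 | h1
  · nlinarith [mul_nonneg (by linarith : (0:ℤ) ≤ -1 - n) (mul_self_nonneg n), sq_nonneg (2 * n + 1)]
  rcases le_or_gt 2 n with h2 | h2
  · nlinarith [mul_nonneg (by linarith : (0:ℤ) ≤ n - 2) (mul_self_nonneg n),
      mul_nonneg (by linarith : (0:ℤ) ≤ n - 2) (by linarith : (0:ℤ) ≤ 2 * n + 1)]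
  interval_cases n <;> omega

/-- `t³ = 3t − 1` has no integer root. -/
private theorem noIntRoot_cond9 : ∀ n : ℤ, n * n * n ≠ 0 * n * n + 3 * n + (-1) := by
  intro n h
  rcases le_or_gt n (-3) with h1 | h1
  · nlinarith [mul_nonneg (by linarith : (0:ℤ) ≤ -3 - n) (mul_self_nonneg n),
      mul_nonneg (by linarith : (0:ℤ) ≤ -3 - n) (by linarith : (0:ℤ) ≤ -1 - n)]
  rcases le_or_gt 3 n with h2 | h2
  · nlinarith [mul_nonneg (by linarith : (0:ℤ) ≤ n - 3) (mul_self_nonneg n),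
      mul_nonneg (by linarith : (0:ℤ) ≤ n - 1) (by linarith : (0:ℤ) ≤ n)]
  interval_cases n <;> omega

/-- **Heptagonal class** `t³ = 2t² + t − 1`: certificate over `𝔽₈` (`θ³ = θ + 1` in characteristic 2). -/
theorem linearIndependent_pencil_heptagonal_of_charTwo (𝒜 : Finset (Finset α))
    {F : Type*} [Field F] [CharP F 2] {θ : F} (hθ : θ * θ * θ = θ + 1)
    (hF : LinearIndependent F (fun A : 𝒜 => fun E : (𝒜 \\ 𝒜 : Finset (Finset α)) =>
      (if (E : Finset α) ⊆ (A : Finset α) then (1 : F) else 0) +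
        θ * (if Disjoint (E : Finset α) (A : Finset α) then (1 : F) else 0)))
    {K : Type*} [Field K] [CharZero K] {t : K} (ht : t * t * t = 2 * t * t + t - 1) :
    LinearIndependent K (fun A : 𝒜 => fun E : (𝒜 \\ 𝒜 : Finset (Finset α)) =>
      (if (E : Finset α) ⊆ (A : Finset α) then (1 : K) else 0) +
        t * (if Disjoint (E : Finset α) (A : Finset α) then (1 : K) else 0)) := by
  haveI : Fact (Nat.Prime 2) := ⟨by norm_num⟩
  have two : (2 : F) = 0 := by
    have := CharP.cast_eq_zero F 2
    exact_mod_cast this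
  refine linearIndependent_pencil_cubic_of_finite_certificate 𝒜 2 1 (-1) 2 noIntRoot_hept noRootMod2_hept ?_ hF
    (by push_cast; linear_combination ht)
  push_cast
  linear_combination hθ + (1 - θ * θ) * two

/-- **Plastic class** `t³ = t + 1`: certificate over `𝔽₈` (`θ³ = θ + 1`). -/
theorem linearIndependent_pencil_plastic_of_charTwo (𝒜 : Finset (Finset α))
    {F : Type*} [Field F] [CharP F 2] {θ : F} (hθ : θ * θ * θ = θ + 1)
    (hF : LinearIndependent F (fun A : 𝒜 => fun E : (𝒜 \\ 𝒜 : Finset (Finset α)) =>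
      (if (E : Finset α) ⊆ (A : Finset α) then (1 : F) else 0) +
        θ * (if Disjoint (E : Finset α) (A : Finset α) then (1 : F) else 0)))
    {K : Type*} [Field K] [CharZero K] {t : K} (ht : t * t * t = t + 1) :
    LinearIndependent K (fun A : 𝒜 => fun E : (𝒜 \\ 𝒜 : Finset (Finset α)) =>
      (if (E : Finset α) ⊆ (A : Finset α) then (1 : K) else 0) +
        t * (if Disjoint (E : Finset α) (A : Finset α) then (1 : K) else 0)) := by
  haveI : Fact (Nat.Prime 2) := ⟨by norm_num⟩
  refine linearIndependent_pencil_cubic_of_finite_certificate 𝒜 0 1 1 2 noIntRoot_plastic noRootMod2_plastic ?_ hF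
    (by push_cast; linear_combination ht)
  push_cast
  linear_combination hθ

/-- **Conductor-9 class** `t³ = 3t − 1` (`2cos(2π/9)`-type unit): certificate over `𝔽₈` (`θ³ = θ + 1`). -/
theorem linearIndependent_pencil_conductorNine_of_charTwo (𝒜 : Finset (Finset α))
    {F : Type*} [Field F] [CharP F 2] {θ : F} (hθ : θ * θ * θ = θ + 1)
    (hF : LinearIndependent F (fun A : 𝒜 => fun E : (𝒜 \\ 𝒜 : Finset (Finset α)) =>
      (if (E : Finset α) ⊆ (A : Finset α) then (1 : F) else 0) +
        θ * (if Disjoint (E : Finset α) (A : Finset α) then (1 : F) else 0)))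
    {K : Type*} [Field K] [CharZero K] {t : K} (ht : t * t * t = 3 * t - 1) :
    LinearIndependent K (fun A : 𝒜 => fun E : (𝒜 \\ 𝒜 : Finset (Finset α)) =>
      (if (E : Finset α) ⊆ (A : Finset α) then (1 : K) else 0) +
        t * (if Disjoint (E : Finset α) (A : Finset α) then (1 : K) else 0)) := by
  haveI : Fact (Nat.Prime 2) := ⟨by norm_num⟩
  have two : (2 : F) = 0 := by
    have := CharP.cast_eq_zero F 2
    exact_mod_cast this
  refine linearIndependent_pencil_cubic_of_finite_certificate 𝒜 0 3 (-1) 2 noIntRoot_cond9 noRootMod2_cond9 ?_ hF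
    (by push_cast; linear_combination ht)
  push_cast
  linear_combination hθ + (1 - θ) * two


end OrderedDifferences

end Summit.CriticalPhenomena.PercolationContinuityZ3.Theorems
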